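import Literature.AlgebraicGeometry.Frobenioids.GeometricDivisorPerfFactorial
import Literature.AlgebraicGeometry.Frobenioids.Prop53SubRlfIsFrobenioid
import HarnessLib

/-!
# Frobenioids I, Prop. 5.3 at Example 6.1: THE realification `C_{K̃/K}^rlf` of the geometric Frobenioid EXISTS
# and IS a Frobenioid — the perf-factoriality binder discharged (PROOFS)

Mochizuki, *The geometry of Frobenioids I: the general theory*, Kyushu J. Math. **62** (2008) 293–400, Ex. 6.1
p. 109 ("a perf-factorial divisorial monoid `Φ` on `D`"), Prop. 5.3 p. 103 ("Suppose that `Φ` is perf-factorial.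
Then we shall refer to as the realification `C^rlf` …"). [cite: MochizukiFrdI2008, Prop. 5.3 p.103]

PROOF-ONLY (theorems, no `def`; cell abc-iut, seat abc-iut-L6-t10 gen 3). The geometric instances of the
Prop. 5.3 sub-DAG — seat abc-iut-L6-t10 gen 2's `geomRlfFunctor_isMonoidOn` ("the divisor monoid `Φ^rlf`" is a
monoid on `D`) and seat abc-iut-w5-d137's `geomFrobenioid_rlfHypotheses` / `geomFrobenioid_rlf_isFrobenioid`
(THE realification IS a Frobenioid of isotropic type) — carry the witness
`hΦ : IsPerfFactorialOn (geomDivisorFunctor Γ)` as a binder; by gen 3's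
`GeometricDivisorData.isPerfFactorial_phi` (Ex. 6.1 "one verifies immediately that `Φ(L)` is perf-factorial",
file `GeometricDivisorPerfFactorial.lean`) the binder is inhabited for EVERY `GeometricDivisorData`, so the
statements hold at THE witness, unconditionally:
`geomDivisorFunctor_isPerfFactorialOn`, `geomRlfFunctor_isMonoidOn'`, `geomFrobenioid_rlfHypotheses'`,
`geomFrobenioid_rlf_isFrobenioid'`, `geomFrobenioid_rlf_isOfIsotropicType`.

Standard axioms only. Nothing here bears on [IUTchIII] Cor. 3.12 or asserts anything about abc.
-/

noncomputable section

namespace Literature.AlgebraicGeometry.Frobenioids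

open CategoryTheory Opposite

section Geom

variable {K : Type} [Field K] {Kt : Type} [Field Kt] [Algebra K Kt] (Γ : GeometricDivisorData K Kt)

/-- "`Φ` is a perf-factorial divisorial monoid on `D`" (Ex. 6.1 p. 109): THE perf-factoriality witness of the
geometric divisor monoid, in the form `IsPerfFactorialOn` that THE realification `PreFrobenioid.rlf` takes.
[cite: MochizukiFrdI2008, Ex. 6.1 p.109] -/
theorem geomDivisorFunctor_isPerfFactorialOn : PreFrobenioid.IsPerfFactorialOn (geomDivisorFunctor Γ) :=
  fun X => Γ.isPerfFactorial_phi X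

variable [IsGalois K Kt]

/-- **"The divisor monoid `Φ^rlf`" IS a monoid on `D` for the geometric `Φ` of Ex. 6.1**, unconditionally (gen 2's
`geomRlfFunctor_isMonoidOn` at THE witness). [cite: MochizukiFrdI2008, Prop. 5.3 p.103] -/
theorem geomRlfFunctor_isMonoidOn' :
    IsMonoidOn (Literature.AnabelianGeometry.EtaleTheta.rlfFunctor (geomDivisorFunctor Γ)
      (Γ.geomDivisorFunctor_isPerfFactorial)) :=
  geomRlfFunctor_isMonoidOn Γ _

/-- **The hypotheses of Thm. 5.2 for the REALIFIED geometric data `(Φ^rlf, ℝ · Φ^birat)`**, unconditionally (seat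
abc-iut-w5-d137's `geomFrobenioid_rlfHypotheses` at THE witness). [cite: MochizukiFrdI2008, Prop. 5.3 p.103] -/
theorem geomFrobenioid_rlfHypotheses' :
    FrdI.Prop53Sub.RlfHypotheses
      (ModelFrobenioid.toElem (geomDivisorFunctor Γ) (geomUnitsFunctor Γ) (geomDivNatTrans Γ))
      (geomDivisorFunctor_isPerfFactorialOn Γ) :=
  geomFrobenioid_rlfHypotheses Γ _

/-- **THE realification `C_{K̃/K}^rlf` of the geometric Frobenioid of Ex. 6.1 IS a Frobenioid**, unconditionally,
for every `GeometricDivisorData` (`K̃/K` Galois). [cite: MochizukiFrdI2008, Prop. 5.3 p.103] -/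
theorem geomFrobenioid_rlf_isFrobenioid' :
    PreFrobenioid.IsFrobenioid
      (PreFrobenioid.rlfToElem
        (ModelFrobenioid.toElem (geomDivisorFunctor Γ) (geomUnitsFunctor Γ) (geomDivNatTrans Γ))
        (geomDivisorFunctor_isPerfFactorialOn Γ)) :=
  (geomFrobenioid_rlf_isFrobenioid Γ _).1

/-- … and of isotropic type. [cite: MochizukiFrdI2008, Prop. 5.3 p.103] -/
theorem geomFrobenioid_rlf_isOfIsotropicType :
    PreFrobenioid.IsOfIsotropicType
      (PreFrobenioid.rlfToElem
        (ModelFrobenioid.toElem (geomDivisorFunctor Γ) (geomUnitsFunctor Γ) (geomDivNatTrans Γ))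
        (geomDivisorFunctor_isPerfFactorialOn Γ)) :=
  (geomFrobenioid_rlf_isFrobenioid Γ _).2

end Geom

end Literature.AlgebraicGeometry.Frobenioids

end
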